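/-
Copyright: the b2b-balaban cell (near-miss cell 7), T⁴-continuum fan-out, lineage t4-ne7b-p2 (node U5c RENEWAL member).
Released under the licence of the surrounding project.
-/
import Summits.QuantumFields.BalabanUV.T4Continuum.Support.RenewalTiltedForest

/-!
# Spine records: the renewal route's ledger realisation (carriers)

Summits-side support leaf of the T⁴-continuum cell (rung (B)+1 on a FINITE torus only; NOT infinite volume, NOT the
mass gap, NOT the Clay statement; NOT a proof of the spine estimate NE7b).  Lineage `t4-ne7b-p2` (generation 23),
node U5c, RENEWAL route; leaf N1a (ledger realisation: the carriers) of the ROUND-2 skeleton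
`t4/skeletons/NE7b-t4-ne7b-p2.md` v1.7; the companions `RenewalRecordsForest` (prefix forest, product majorant, every
ledger fact discharged) and `RenewalRecordsEnd` (the two per-slot bounds) apply `RenewalGroveSum.sum_le_of_grove_product`
∕ `RenewalTiltedForest.sum_tilted_le_of_grove_product` to them.
[folklore] finite combinatorics over the lineage's OWN carriers (`T4PersistenceDictionary.Gen`, `T4PersistenceGrove.Grove
∕ Step ∕ Script`, `T4PersistenceRenewal.EventForest`); nothing is quoted from print, nothing printed is asserted, no
`[cite:]` tag; none of the cell's conditionals ((B), BetaPertH) occurs.  The four `Prop`-valued definitions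
(`Move.Valid`, `BlockValid`, `Rec.ChainValid`, `Rec.Valid`) are PREDICATES on our own records (reach bookkeeping), not
facts.

THE MODEL (§1–§3).  A SPINE RECORD of a live structure at its slot (birth step `j`): the root birth label (tree
`born root j`), a ROOT BLOCK of one-event ledger MOVES at step `j`, and a HISTORY of EDGES — newest first —, each edge
= a gap and a nonempty BLOCK of moves, all at the absolute step `j + (end age of the edge)`; ages are strictly increasing
BY TYPE (`end age (e :: es) = end age es + gap e + 1`).  A MOVE is `renew e` (the spine tree `T ↦ renew T e (u − 1)`:
the structure, ready at `u − 1`, acquires a new large field at step `u`) or `absorb δ e` (`T ↦ merge T (born δ u) e`: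
the structure absorbs at step `u` a partner summarised by the DUMMY label `δ` — whose window `W δ` is where the
instantiating seat books the partner's remaining life beyond `u`, skeleton v1.7 N5⁺ — joined by the event `e`).  The
spine TREE of a record is a FUNCTION of the record (§2), groves are singletons, and VALIDITY (`Move.Valid`: a move at
step `u` needs `u ≤ reach` of the current tree, a renewal also `1 ≤ u`) is a decidable-shaped predicate; §1 proves
`Move.script`∕`block_script`: a valid move ∕ block IS a ledger script (`Step.renew`; `Step.birth` + `Step.merge`).
§3 the undone event `ev`, its determined tail `tailEv` and the bookings (= block windows).

HONEST DEPENDENCY (cell): continuum YM on T⁴ ⇐ BetaPertH ∧ nine spine estimates (0/9 proved); BetaPertH ⇐ (D1) ∧ (D4)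
∧ CAP+tail.  This file changes none of it.
-/

open Finset
open Literature.MathematicalPhysics.QuantumFieldTheory.Balaban1983to89
open T4PersistenceDictionary T4PersistenceRenewal T4PersistenceGrove

namespace Summit.QuantumFields.BalabanUV.T4Continuum.RenewalRecords

/-! ## §1 One-event moves of the spine tree and blocks of moves at one step -/

/-- **MOVE** of the spine tree at an absolute step `u`: `renew e` — a renewal with event label `e`
(`T ↦ renew T e (u − 1)`); `absorb δ e` — absorption of a partner summarised by the dummy label `δ`, joined by the event
`e` (`T ↦ merge T (born δ u) e`). [folklore] -/
inductive Move (ε : Type*) : Type _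
  | renew (e : ε) : Move ε
  | absorb (δ e : ε) : Move ε
  deriving DecidableEq

namespace Move

variable {ε : Type*}

/-- the spine tree after the move at step `u` [folklore] -/
def apply : Move ε → ℕ → Gen ε → Gen ε
  | renew e, u, T => Gen.renew T e (u - 1)
  | absorb δ e, u, T => Gen.merge T (Gen.born δ u) e

/-- the ledger events of the move, in order of application [folklore] -/
def events : Move ε → ℕ → List (ε × ℕ)
  | renew e, u => [(e, u)]
  | absorb δ e, u => [(δ, u), (e, u)]

/-- the label of the FIRST ledger event of the move [folklore] -/
def head : Move ε → ε
  | renew e => e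
  | absorb δ _ => δ

/-- the remaining ledger events of the move after the first [folklore] -/
def after : Move ε → ℕ → List (ε × ℕ)
  | renew _, _ => []
  | absorb _ e, u => [(e, u)]

/-- the total own window of the move [folklore] -/
def window (W : ε → ℕ) : Move ε → ℕ
  | renew e => W e
  | absorb δ e => W δ + W e

/-- **VALIDITY** of the move at step `u` on the tree `T`: the event happens while the structure is booked alive,
`u ≤ reach T` (a renewal at `u = h + 1` needs `h < reach`, i.e. `1 ≤ u ≤ reach`). [folklore] -/
def Valid (W : ε → ℕ) : Move ε → ℕ → Gen ε → Prop
  | renew _, u, T => 1 ≤ u ∧ u ≤ T.reach W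
  | absorb _ _, u, T => u ≤ T.reach W

/-- reach after a renewal at step `u ≥ 1`: `u + W e` [folklore] -/
theorem reach_apply_renew (W : ε → ℕ) (e : ε) {u : ℕ} (hu : 1 ≤ u) (T : Gen ε) :
    ((renew e).apply u T).reach W = u + W e := by
  simp only [apply, Gen.reach_renew]; omega

/-- reach after an absorption at step `u`: `max (reach T) (u + W δ) + W e` [folklore] -/
@[simp] theorem reach_apply_absorb (W : ε → ℕ) (δ e : ε) (u : ℕ) (T : Gen ε) :
    ((absorb δ e).apply u T).reach W = max (T.reach W) (u + W δ) + W e := by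
  simp [apply]

/-- a valid move does not shorten the reach below its own step plus window, nor below the old reach for an
absorption; in either case `reach T ≤ reach (apply) ` may fail only for a renewal, whose reach is `u + W e ≥ u`
[folklore] -/
theorem step_le_reach_apply (W : ε → ℕ) {m : Move ε} {u : ℕ} {T : Gen ε} (h : m.Valid W u T) :
    u ≤ (m.apply u T).reach W := by
  cases m with
  | renew e => obtain ⟨h1, -⟩ := h; rw [reach_apply_renew W e h1]; omega
  | absorb δ e => have h' : u ≤ T.reach W := h; rw [reach_apply_absorb]; omega

/-- the events of a move are its head event followed by the rest [folklore] -/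
theorem events_eq (m : Move ε) (u : ℕ) : m.events u = (m.head, u) :: m.after u := by
  cases m <;> rfl

/-- the windows of the move's events add up to its own window [folklore] -/
@[simp] theorem windows_events (W : ε → ℕ) (m : Move ε) (u : ℕ) : windows W (m.events u) = m.window W := by
  cases m <;> simp [events, window, windows]

/-- … head plus rest [folklore] -/
theorem window_eq (W : ε → ℕ) (m : Move ε) (u : ℕ) : m.window W = W m.head + windows W (m.after u) := by
  cases m <;> simp [window, head, after, windows]

/-- **A VALID MOVE IS A LEDGER SCRIPT** on the singleton grove: `renew` = `Step.renew`; `absorb` = `Step.birth` of the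
dummy (while alive) then `Step.merge` (both partners alive at `u`). [folklore] -/
theorem script (W : ε → ℕ) {m : Move ε} {u : ℕ} {T : Gen ε} (h : m.Valid W u T) :
    Script W ({T} : Grove ε) (m.events u) {m.apply u T} := by
  cases m with
  | renew e =>
      obtain ⟨h1, h2⟩ := h
      obtain ⟨h', rfl⟩ : ∃ h', u = h' + 1 := ⟨u - 1, by omega⟩
      have hh : h' < T.reach W := by omega
      have hs := Step.renew (W := W) (g := (0 : Grove ε)) (e := e) hh
      simp only [Multiset.cons_zero] at hs
      simpa [events, apply] using Script.single hs
  | absorb δ e =>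
      have h' : u ≤ T.reach W := h
      have hb : Step W ({T} : Grove ε) δ u (Gen.born δ u ::ₘ {T}) := Step.birth (by simpa using h')
      have hm : Step W (Gen.born δ u ::ₘ {T}) e u {Gen.merge T (Gen.born δ u) e} := by
        have hs := Step.merge (W := W) (g := (0 : Grove ε)) (X := T) (Y := Gen.born δ u) (e := e) (s := u) h'
          (by simp)
        rw [Multiset.cons_swap] at hs
        simpa only [Multiset.cons_zero] using hs
      exact Script.cons hb (Script.single hm)

end Move

section Blocks

variable {ε : Type*}

/-- the spine tree after a block of moves at step `u`, applied in order [folklore] -/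
def applyBlock : List (Move ε) → ℕ → Gen ε → Gen ε
  | [], _, T => T
  | m :: b, u, T => applyBlock b u (m.apply u T)

/-- the ledger events of a block [folklore] -/
def blockEvents : List (Move ε) → ℕ → List (ε × ℕ)
  | [], _ => []
  | m :: b, u => m.events u ++ blockEvents b u

/-- the total own window of a block [folklore] -/
def blockWindow (W : ε → ℕ) : List (Move ε) → ℕ
  | [] => 0
  | m :: b => m.window W + blockWindow W b

/-- validity of a block: each move valid on the tree it is applied to [folklore] -/
def BlockValid (W : ε → ℕ) : List (Move ε) → ℕ → Gen ε → Prop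
  | [], _, _ => True
  | m :: b, u, T => m.Valid W u T ∧ BlockValid W b u (m.apply u T)

/-- windows of concatenated event lists add [folklore] -/
theorem windows_append (W : ε → ℕ) (l l' : List (ε × ℕ)) : windows W (l ++ l') = windows W l + windows W l' := by
  simp [windows]

/-- the windows of a block's events add up to the block window [folklore] -/
@[simp] theorem windows_blockEvents (W : ε → ℕ) (b : List (Move ε)) (u : ℕ) :
    windows W (blockEvents b u) = blockWindow W b := by
  induction b with
  | nil => simp [blockEvents, blockWindow]
  | cons m b ih => rw [blockEvents, windows_append, Move.windows_events, ih, blockWindow]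

/-- **A VALID BLOCK IS A LEDGER SCRIPT** on the singleton grove. [folklore] -/
theorem block_script (W : ε → ℕ) {b : List (Move ε)} {u : ℕ} {T : Gen ε} (h : BlockValid W b u T) :
    Script W ({T} : Grove ε) (blockEvents b u) {applyBlock b u T} := by
  induction b generalizing T with
  | nil => exact Script.nil _
  | cons m b ih => exact (Move.script W h.1).append (ih h.2)

/-- a valid NONEMPTY block keeps the structure booked alive at its own step: `u ≤ reach` afterwards [folklore] -/
theorem step_le_reach_applyBlock (W : ε → ℕ) {b : List (Move ε)} (hb : b ≠ []) {u : ℕ} {T : Gen ε}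
    (h : BlockValid W b u T) : u ≤ (applyBlock b u T).reach W := by
  induction b generalizing T with
  | nil => exact absurd rfl hb
  | cons m b ih =>
      cases b with
      | nil => exact Move.step_le_reach_apply W h.1
      | cons m' b' => exact ih (List.cons_ne_nil _ _) h.2

end Blocks

/-! ## §2 Spine records (history newest first); the tree, the end age, truncation -/

/-- **EDGE**: a gap and a NONEMPTY block (first move + rest); its end age is the previous end age `+ gap + 1`.
[folklore] -/
structure Edge (ε : Type*) where
  /-- idle steps since the previous edge -/
  gap : ℕ
  /-- first move of the block -/
  first : Move ε
  /-- remaining moves of the block -/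
  rest : List (Move ε)
  deriving DecidableEq

/-- the block of an edge [folklore] -/
def Edge.block {ε : Type*} (e : Edge ε) : List (Move ε) := e.first :: e.rest

/-- **SPINE RECORD**: root label, root block (moves at the birth step), history of edges NEWEST FIRST. [folklore] -/
structure Rec (ε : Type*) where
  /-- the root birth label: tree `born root j` -/
  root : ε
  /-- the root block: moves at the birth step `j` -/
  tail : List (Move ε)
  /-- the edges, newest first -/
  hist : List (Edge ε)
  deriving DecidableEq

section Records

variable {ε : Type*}

/-- END AGE of a history (newest first): `0` for none, else previous end age `+ gap + 1`. [folklore] -/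
def endAge : List (Edge ε) → ℕ
  | [] => 0
  | e :: es => endAge es + e.gap + 1

/-- the root tree of a record at birth step `j`: the root block applied to `born root j` [folklore] -/
def rootTree (j : ℕ) (root : ε) (tail : List (Move ε)) : Gen ε := applyBlock tail j (Gen.born root j)

/-- the spine tree after a history, from a root tree [folklore] -/
def treeOf (j : ℕ) (T₀ : Gen ε) : List (Edge ε) → Gen ε
  | [] => T₀
  | e :: es => applyBlock e.block (j + endAge (e :: es)) (treeOf j T₀ es)

namespace Rec

/-- the age of the last event block (`0` on a bare root) [folklore] -/
def last (r : Rec ε) : ℕ := endAge r.hist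

/-- **THE SPINE TREE OF THE RECORD** at birth step `j` — a function of the record. [folklore] -/
def tree (j : ℕ) (r : Rec ε) : Gen ε := treeOf j (rootTree j r.root r.tail) r.hist

/-- truncation at the last edge (the record with its newest edge undone; identity on a bare root) [folklore] -/
def parent (r : Rec ε) : Rec ε := ⟨r.root, r.tail, r.hist.tail⟩

/-- the record with its `n` newest edges undone [folklore] -/
def cut (r : Rec ε) (n : ℕ) : Rec ε := ⟨r.root, r.tail, r.hist.drop n⟩

/-- all truncations of a record [folklore] -/
def prefixes [DecidableEq ε] (r : Rec ε) : Finset (Rec ε) := (range (r.hist.length + 1)).image r.cut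

/-- validity of a history from a root tree: every block valid on the tree it is applied to [folklore] -/
def ChainValid (W : ε → ℕ) (j : ℕ) (T₀ : Gen ε) : List (Edge ε) → Prop
  | [] => True
  | e :: es => ChainValid W j T₀ es ∧ BlockValid W e.block (j + endAge (e :: es)) (treeOf j T₀ es)

/-- **VALIDITY OF A RECORD** at birth step `j`: the root block is valid on `born root j` and every edge block is
valid on the tree before it. [folklore] -/
def Valid (W : ε → ℕ) (j : ℕ) (r : Rec ε) : Prop :=
  BlockValid W r.tail j (Gen.born r.root j) ∧ ChainValid W j (rootTree j r.root r.tail) r.hist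

/-- cutting nothing [folklore] -/
@[simp] theorem cut_zero (r : Rec ε) : r.cut 0 = r := rfl

/-- the parent of a truncation is the next truncation [folklore] -/
theorem parent_cut (r : Rec ε) (n : ℕ) : (r.cut n).parent = r.cut (n + 1) := by
  simp [parent, cut, List.tail_drop]

/-- a record is one of its prefixes [folklore] -/
theorem mem_prefixes_self [DecidableEq ε] (r : Rec ε) : r ∈ r.prefixes :=
  mem_image.2 ⟨0, by simp, rfl⟩

/-- membership in the prefixes [folklore] -/
theorem mem_prefixes [DecidableEq ε] {r c : Rec ε} : c ∈ r.prefixes ↔ ∃ n ≤ r.hist.length, c = r.cut n := by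
  simp only [prefixes, mem_image, mem_range, Nat.lt_succ_iff, eq_comm]

/-- a truncation with a nonempty history has its parent among the prefixes [folklore] -/
theorem parent_cut_mem_prefixes [DecidableEq ε] (r : Rec ε) {n : ℕ} (hn : (r.cut n).hist ≠ []) :
    (r.cut n).parent ∈ r.prefixes := by
  rw [parent_cut]
  refine mem_prefixes.2 ⟨n + 1, ?_, rfl⟩
  by_contra h
  exact hn (List.drop_eq_nil_of_le (by omega))

/-- the end age of a truncation is at most the end age [folklore] -/
theorem endAge_drop_le (l : List (Edge ε)) (n : ℕ) : endAge (l.drop n) ≤ endAge l := by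
  induction n generalizing l with
  | zero => simp
  | succ n ih =>
      cases l with
      | nil => simp
      | cons e es =>
          rw [List.drop_succ_cons, endAge]
          exact (ih es).trans (by omega)

/-- validity is inherited by truncations [folklore] -/
theorem chainValid_drop {W : ε → ℕ} {j : ℕ} {T₀ : Gen ε} {l : List (Edge ε)} (h : ChainValid W j T₀ l) (n : ℕ) :
    ChainValid W j T₀ (l.drop n) := by
  induction n generalizing l with
  | zero => simpa using h
  | succ n ih =>
      cases l with
      | nil => simpa using h
      | cons e es => exact ih h.1

/-- … hence by every prefix of a valid record [folklore] -/
theorem valid_cut {W : ε → ℕ} {j : ℕ} {r : Rec ε} (h : r.Valid W j) (n : ℕ) : (r.cut n).Valid W j :=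
  ⟨h.1, chainValid_drop h.2 n⟩

end Rec

end Records

/-! ## §3 The undone event of a component and its determined tail; bookings -/

section Events

variable {ε : Type*}

namespace Rec

/-- the label of the FIRST ledger event of the newest block (the root label on a bare root) [folklore] -/
def ev (r : Rec ε) : ε :=
  match r.hist with
  | [] => r.root
  | e :: _ => e.first.head

/-- the remaining ledger events of the newest block (the root block's events on a bare root) [folklore] -/
def tailEv (j : ℕ) (r : Rec ε) : List (ε × ℕ) :=
  match r.hist with
  | [] => blockEvents r.tail j
  | e :: _ => e.first.after (j + r.last) ++ blockEvents e.rest (j + r.last)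

/-- on an edge, head event `::` tail events IS the newest block's event list at step `j + last` [folklore] -/
theorem ev_cons_tailEv (j : ℕ) (r : Rec ε) (e : Edge ε) (es : List (Edge ε)) (hr : r.hist = e :: es) :
    (r.ev, j + r.last) :: r.tailEv j = blockEvents e.block (j + r.last) := by
  simp only [ev, tailEv, hr, Edge.block, blockEvents, Move.events_eq e.first, List.cons_append]

/-- the booking of an edge component is its newest block's own window [folklore] -/
theorem booking_edge (W : ε → ℕ) (j : ℕ) (r : Rec ε) (e : Edge ε) (es : List (Edge ε)) (hr : r.hist = e :: es) :
    booking W ev (tailEv j) r = blockWindow W e.block := by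
  have h := congrArg (windows W) (ev_cons_tailEv j r e es hr)
  rw [windows_cons, windows_blockEvents] at h
  simpa [booking] using h

/-- the booking of a bare root is the root window plus the root block's window [folklore] -/
theorem booking_root (W : ε → ℕ) (j : ℕ) (r : Rec ε) (hr : r.hist = []) :
    booking W ev (tailEv j) r = W r.root + blockWindow W r.tail := by
  simp [booking, ev, tailEv, hr]

end Rec

end Events

end Summit.QuantumFields.BalabanUV.T4Continuum.RenewalRecords
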